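/-
Copyright (c) 2026 the pub-hodgecm-mathlib formalisation cell (harness21).  Prover seat hodgecm-mathlib-K2E3-p31 (g0), HCML Track B «K2-LIT»,
h413 = `stmt-HodgeConjecture-24833`, line `K2_E3_EllipticInputs`, unit U12 «Characters», PART «SC» (ED. 2) leaf (SC-an)₂
`sig_K2E3SupercuspidalTruncatedCharAnalyticTwo`, road «FC₂» ∕ (M5h₂) chain (LINE-LEAD K2E3-plan (g4) L4 EMIT #1 deal D136 BY NAME 2026-09-04T14:52:25Z, FILE 2):
brick [M2a]₂ FILE B «THE CARTAN DICHOTOMY AND THE SUPPORT DATUM OF THE SUPERCUSPIDAL SLICE ON THE ONE-PLACE MODEL `U(σ_w, Φ₂)(L_w)`», the `Fin 2` twin of ★ [M2a]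
FILE B `K2E3SupercuspModelFrameAtPlaceCartan` (K2E3-p14 (g3)).  2026-09-04.
-/
import Summits.HodgeConjecture.HodgeConjecture.Theorems.K2E3SupercuspModelFrameAtPlaceTwo      -- ★ [M2a]₂ FILE A (this seat, p861132): `isCompact_center_of_eq_over`, `locallyCompactSpace_unitaryGroupOfForm_adicCompletion`;
                                                                                             --   brings ★ [M2a] (N-agnostic heads), ★ `F0P3cCMLocalNonsplitBorelTransportU2` (`placeForm_antidiagTwo_eq`, `localNonsplitEquiv_mem_torusU_iff₂`)
import Summits.HodgeConjecture.HodgeConjecture.Theorems.F0P3cStCharTSEllCartanCompactH         -- ★ (F0P3a-p03 g26) «ELL-CARTAN-COMPACT-H★»: `isCompact_centralizer_iff_not_mem_hyperbolicSet_H`; brings ★ (B3) `F0P3cStCharTSHypConjTwo`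
                                                                                             --   (`exists_conj_mem_torusU_of_isRoot_of_isUnit₂`), ★ (B2) `F0P3cStCharTSStableInvariantsH` (`exists_isRoot_charpoly_fst_of_mem_hyperbolicSet`)
import Summits.HodgeConjecture.HodgeConjecture.Theorems.F0P3cStCharTSCartanEllH                 -- ★ (F0P3a-p03) «G-REGULAR COMPLETION»: `exists_isLocalGRegular` (a partner `b ∈ U(Φ₁)(L⁺_v)` making `(a, b)` `G`-regular)
import Summits.HodgeConjecture.HodgeConjecture.Theorems.F0P3cStCharTSWeylHypFibre               -- ★ `centralizer_eq_torusU_of_isRegularElt`, `isUnit_sub_of_isRegularElt_glDiagonal`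
import Summits.HodgeConjecture.HodgeConjecture.Theorems.F0P3cStCharTSWeylHypCM                  -- ★ `isUnit_of_ne_zero_of_nonsplit` (`E_v` is field-like at a non-split place), `nontrivial_localRing`
import Summits.HodgeConjecture.HodgeConjecture.Theorems.F0P3cStCharTSEllipticCriterion           -- ★ `isRegularElt_coe_conj_iff`
import Summits.HodgeConjecture.HodgeConjecture.Theorems.K2E3UnipotentConjTwistBochner           -- ★ p856617 `exists_isCompact_subset_mul_of_isCompact_image_mk` (Lemma 14's output read as `supp ⊆ C·T`)
import Literature.NumberTheory.Rogawski1990.RegularOrbitalIntegralLocallyConstantCM            -- ★ `isRegularElt_iff_charpoly_separable_localNonsplitEquiv` (any `N`)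
import Literature.NumberTheory.Automorphic.ConjugationProperOnRegularCompactaLocal               -- ★ model-level Lemma 14 `UnitaryGroupOfForm.isCompact_image_mk_setOf_exists_conj_mem_of_charpoly_separable` (any `m`)
import Literature.MeasureTheory.Group.InvariantQuotientOrbitalTransport                       -- ★ `forall_apply_mem_centralizer_singleton_iff_of_eq` (centralisers along a group isomorphism)
import Literature.NumberTheory.Automorphic.RegularDiagonalCentralizer                           -- ★ `mem_torusU_iff_mem_centralizer_of_isUnit_sub` (`Z(t) = T` for regular diagonal `t`, any `N`)
import Literature.NumberTheory.Automorphic.AdmissibleInvariantFormSchur                         -- ★ `IsSupercuspidal.hasCompactSupport_sesqForm_apply_apply`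
import HarnessLib

/-!
# h413 ∕ Track B «K2-LIT», line `K2_E3_EllipticInputs`, unit U12, PART «SC» leaf (SC-an)₂, road «FC₂» ∕ (M5h₂) chain — brick [M2a]₂, FILE B: THE CARTAN DICHOTOMY AND
# THE SUPPORT DATUM OF THE SUPERCUSPIDAL SLICE ON THE ONE-PLACE MODEL `U(σ_w, Φ₂)(L_w)` (Rogawski 1990, §3.6, §12.5; Harish-Chandra 1970, Part I §3 Lemma 14, Part VII §2 (i))

Cell `pub/hodgecm-mathlib`, crux H413 = `stmt-HodgeConjecture-24833`, route of record `HCCMUnconditional`; chair K2-lead (g2), L4 LINE-LEAD ∕ dealer K2E3-plan (g4),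
architect K2E3-p25 (g3), (M5h₂) chain desk K2E3-p27 (g0).  THEOREMS ONLY (no `def`, no `instance`, no `notation`, no named-fact hypothesis, no `sorry`); lane
`--supports stmt-HodgeConjecture-24833 --as helper`, count-neutral.  Sequel of ★ [M2a]₂ FILE A `K2E3SupercuspModelFrameAtPlaceTwo` (scalars, centre, instances,
unimodularity); here items (d) and (f) of the [M2a] deal at `N = 2`, with the SAME head names as the `Fin 3` original ★ `K2E3SupercuspModelFrameAtPlaceCartan` (K2E3-p14 (g3)),
in the namespace `…Cruxes.H413.K2E3SupercuspModelFrameAtPlaceCartanTwo`, so that the (M5h₂) ports of ★ `…RadiusDatum` ∕ ★ `…LimCanc` re-point by a namespace substitution.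

SETTING.  `K := L_w = w.1.adicCompletion L` at a place `w ∣ v` fixed by complex conjugation (`v` non-split), `σ := σ_w`, `J = Φ₂` in the generic currency
`{J} (hJ : J = (StdForm.antidiagonal 2).over L_w)`, `U := U(σ_w, J)(L_w)`, `T := torusU σ_w J` (diagonal torus `{d(a, σ_w(a)⁻¹)}`).
* §1a (NEW at `N = 2`, the CM input of §1) **`exists_conj_cmTorus_of_not_isCompact_centralizer₂`** — ON `G₂ = U(Φ₂)(L⁺_v)`: a REGULAR `γ₀` whose centraliser is NOT compact is
  `γ₀ = x m x⁻¹` with `m ∈ M₂ = (cmBorelTriple L 2 v).M` regular and `g ∈ Z(γ₀) ↔ x⁻¹ g x ∈ M₂` — the `N = 2` twin of ★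
  `F0P3cStCharTSEllCartanCompact.exists_conj_cmTorus_of_not_isCompact_centralizer`, obtained by ENDOSCOPIC INHERITANCE exactly as ★ `F0P3cStCharTSEllCartanCompactH`: a
  `G`-regular partner `b ∈ U(Φ₁)(L⁺_v)` (★ `F0P3cStCharTSCartanEllH.exists_isLocalGRegular`), `fst '' Z_H((γ₀, b)) = Z(γ₀)` (so `Z_H` is not compact), hence `ι_v(γ₀, b) ∈ Ω`
  (★ `isCompact_centralizer_iff_not_mem_hyperbolicSet_H`), hence a root `α` of `χ_{γ₀}` with `α σ(α) ≠ 1` (★ (B2) `exists_isRoot_charpoly_fst_of_mem_hyperbolicSet`), hence `γ₀`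
  is `U(Φ₂)`-conjugate into `M₂` (★ (B3) `exists_conj_mem_torusU_of_isRoot_of_isUnit₂` over the field-like `E_v`, ★ `isUnit_of_ne_zero_of_nonsplit`) with `Z = Ad(x) M₂` (★
  `centralizer_eq_torusU_of_isRegularElt`).  [Rogawski1990 §3.6: in `U(2)` the Cartan subgroups are the split `M₂ ≅ E^×` (type (0)) and the compact ones.]
* §1 (d) **THE CARTAN DICHOTOMY AT THE MODEL** `exists_conj_torusU_of_not_isCompact_centralizer`: a REGULAR `g ∈ U` whose centraliser is NOT compact is `g = y t y⁻¹` with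
  `t = diag d ∈ T` regular, and `h ∈ Z(g) ↔ y⁻¹ h y ∈ T` — §1a transported along ★ `localNonsplitEquiv` (regularity ★ `isRegularElt_iff_charpoly_separable_localNonsplitEquiv`,
  torus ★ `localNonsplitEquiv_mem_torusU_iff₂`, centralisers ★ `forall_apply_mem_centralizer_singleton_iff_of_eq`); the template's proof with `3 ↦ 2`.
* §2 (f) **THE SUPPORT DATUM OF THE SUPERCUSPIDAL SLICE AT THE MODEL** `exists_isCompact_support_coeff_conj_subset_mul_torusU`: for `ρ` smooth supercuspidal on `U` with a
  `U`-invariant sesquilinear `B`, and `t = diag d` regular: `∃ C` compact with `B u′ (ρ (x t x⁻¹) u) ≠ 0 ⇒ x ∈ C·T` — Harish-Chandra's Lemma 14 at the model (★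
  `UnitaryGroupOfForm.isCompact_image_mk_setOf_exists_conj_mem_of_charpoly_separable` at `m := 2`, `K = {t}`, `C = tsupport θ`; `θ` compactly supported by ★
  `IsSupercuspidal.hasCompactSupport_sesqForm_apply_apply` and the compact centre ★ FILE A₂ `isCompact_center_of_eq_over`), read through ★ `exists_isCompact_subset_mul_of_isCompact_image_mk`
  and `Z(t) = T` (★ `mem_torusU_iff_mem_centralizer_of_isUnit_sub`, ★ `isUnit_sub_of_isRegularElt_glDiagonal`) — token-for-token the template (every input is `n`-generic;
  `Φ₂` hermitian with unit determinant through ★ `StdForm.over_map` ∕ `StdForm.transpose_over` ∕ `StdForm.isUnit_over`, as ★ `K2E3EllWeightPlaceOfFinConjTwo` does).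

HONEST LABEL.  HC_CM is proved only modulo the 7 printed citations (2 remaining named inputs: hLiu418 = `stmt-HodgeConjecture-24832`, h413 = `stmt-HodgeConjecture-24833`)
until rung 0 closes; this file is a count-neutral helper (place-level plumbing; nothing printed is asserted as a fact); (SC-an)₂ stays OPEN until COLL₂ + NC₂ + the whole (M5h₂)
chain are ★.

## References
* [Rogawski1990] J. D. Rogawski, *Automorphic Representations of Unitary Groups in Three Variables*, Ann. of Math. Stud. 123 (1990), §3.6 pp. 28–31 (Cartan subgroups of `U(2)`,
  `U(2) × U(1)` and `U(3)`: type (0) = `M`, the others compact modulo the centre), §4.3 p. 42 (`G`-regular elements of `H`), §4.8 Case (a) p. 53 (`ι : H ⊂ G`), §4.9 p. 54,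
  §12.5 pp. 182–184 (the hyperbolic set; elliptic = compact Cartan).
* [HarishChandra1970] Harish-Chandra (notes by G. van Dijk), *Harmonic Analysis on Reductive p-adic Groups*, LNM 162 (1970), Part I §3 Lemma 14 p. 9; Part VII §2 p. 70 (i).
* [PlatonovRapinchuk1994] V. Platonov, A. Rapinchuk, *Algebraic Groups and Number Theory* (1994), §2.3, §3.3, §5.1.
-/

set_option autoImplicit false
set_option linter.dupNamespace false  -- the mandated namespace repeats the single-problem summit's segment (`HodgeConjecture.HodgeConjecture`)

noncomputable section

open NumberField IsDedekindDomain MeasureTheory Measure Filter Topology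
open Literature.NumberTheory.Automorphic Literature.NumberTheory.Automorphic.UnitaryGroup Literature.NumberTheory.GaloisRepresentations
open Literature.NumberTheory.Rogawski1990 ValuativeRel
open scoped Matrix MatrixGroups Pointwise

namespace Summit.HodgeConjecture.HodgeConjecture.Cruxes.H413.K2E3SupercuspModelFrameAtPlaceCartanTwo

variable (L : Type) [Field L] [NumberField L] [IsCMField L] {v : HeightOneSpectrum (𝓞 ↥(maximalRealSubfield L))}

/-! ## §1a The Cartan dichotomy on `G₂ = U(Φ₂)(L⁺_v)` (CM carrier): a regular element with non-compact centraliser is conjugate into the split torus `M₂` -/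

set_option maxHeartbeats 1600000 in  -- statement-level `whnf` on the CM carriers (`(cmDatum L 2 Φ₂).Local v` vs `U(conjLocal, cmLocalForm L 2 v)`), same class as ★ `F0P3cStCharTSEllCartanCompactH`
/-- **A NON-COMPACT CARTAN SUBGROUP OF `U(Φ₂)(L⁺_v)` IS CONJUGATE TO THE SPLIT TORUS `M₂`** (`v` non-split): if `γ₀ ∈ G₂ = U(Φ₂)(L⁺_v)` is regular and `Z(γ₀)` is not compact,
then `γ₀ = x m x⁻¹` with `m ∈ M₂ = (cmBorelTriple L 2 v).M` regular, and `g ∈ Z(γ₀) ↔ x⁻¹ g x ∈ M₂`.  ENDOSCOPIC INHERITANCE: a partner `b ∈ U(Φ₁)(L⁺_v)` with `(γ₀, b)`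
`G`-regular (★ `exists_isLocalGRegular`); `fst '' Z_H((γ₀, b)) = Z(γ₀)`, so `Z_H((γ₀, b))` is not compact; hence `ι_v(γ₀, b) ∈ Ω` (★ `isCompact_centralizer_iff_not_mem_hyperbolicSet_H`),
so `χ_{γ₀}` has a root `α` with `α σ(α) ≠ 1` (★ `exists_isRoot_charpoly_fst_of_mem_hyperbolicSet`), so `x₀ γ₀ x₀⁻¹ ∈ M₂` for some `x₀ ∈ G₂` (★ `exists_conj_mem_torusU_of_isRoot_of_isUnit₂`,
`E_v` field-like by ★ `isUnit_of_ne_zero_of_nonsplit`) and `Z(x₀ γ₀ x₀⁻¹) = M₂` (★ `centralizer_eq_torusU_of_isRegularElt`).  The `N = 2` twin of ★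
`F0P3cStCharTSEllCartanCompact.exists_conj_cmTorus_of_not_isCompact_centralizer`. [cite: Rogawski1990, §3.6 pp. 28–31; §12.5 pp. 182, 184; §4.3 p. 42] -/
theorem exists_conj_cmTorus_of_not_isCompact_centralizer₂ (hns : ∀ w : PlacesOver L v, IsCMField.complexConj L • w.1 = w.1)
    {γ₀ : ↥(unitaryGroupOfForm (conjLocal L (IsCMField.complexConj L) v) (cmLocalForm L 2 v))}
    (hreg : IsRegularElt (γ₀ : GL (Fin 2) (LocalRing L v)))
    (hnc : ¬ IsCompact ((Subgroup.centralizer ({γ₀} : Set ↥(unitaryGroupOfForm (conjLocal L (IsCMField.complexConj L) v) (cmLocalForm L 2 v)))) :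
      Set ↥(unitaryGroupOfForm (conjLocal L (IsCMField.complexConj L) v) (cmLocalForm L 2 v)))) :
    ∃ (x : ↥(unitaryGroupOfForm (conjLocal L (IsCMField.complexConj L) v) (cmLocalForm L 2 v))) (m : ↥(cmBorelTriple L 2 v).M),
      IsRegularElt (((m : ↥(unitaryGroupOfForm (conjLocal L (IsCMField.complexConj L) v) (cmLocalForm L 2 v))) : GL (Fin 2) (LocalRing L v))) ∧
      x * (m : ↥(unitaryGroupOfForm (conjLocal L (IsCMField.complexConj L) v) (cmLocalForm L 2 v))) * x⁻¹ = γ₀ ∧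
      ∀ g : ↥(unitaryGroupOfForm (conjLocal L (IsCMField.complexConj L) v) (cmLocalForm L 2 v)),
        g ∈ Subgroup.centralizer ({γ₀} : Set ↥(unitaryGroupOfForm (conjLocal L (IsCMField.complexConj L) v) (cmLocalForm L 2 v))) ↔
          x⁻¹ * g * x ∈ (cmBorelTriple L 2 v).M := by
  haveI : Nontrivial (LocalRing L v) := F0P3cStCharTSWeylHypCM.nontrivial_localRing L v
  have hR := F0P3cStCharTSWeylHypCM.isUnit_of_ne_zero_of_nonsplit L v hns
  -- `γ₀` on the CM-datum carrier `(cmDatum L 2 Φ₂).Local v` (definitionally the same topological group)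
  let a : (UnitaryGroup.cmDatum L 2 (Matrix.of fun i j : Fin 2 => if i.val + j.val + 1 = 2 then (1 : L) else 0)).Local v := γ₀
  have ha : IsRegularElt (a.val : GL (Fin 2) (LocalRing L v)) := hreg
  -- a `G`-regular partner `b ∈ U(Φ₁)(L⁺_v)`
  obtain ⟨b, hγ⟩ := F0P3cStCharTSCartanEllH.exists_isLocalGRegular L v hns a ha
  -- `fst '' Z_H((a, b)) = Z(γ₀)`, so `Z_H((a, b))` is not compact
  have himg : Prod.fst '' ((Subgroup.centralizer ({(a, b)} :
      Set ((UnitaryGroup.cmDatum L 2 (Matrix.of fun i j : Fin 2 => if i.val + j.val + 1 = 2 then (1 : L) else 0)).Local v ×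
        (UnitaryGroup.cmDatum L 1 (Matrix.of fun i j : Fin 1 => if i.val + j.val + 1 = 1 then (1 : L) else 0)).Local v))) :
      Set ((UnitaryGroup.cmDatum L 2 (Matrix.of fun i j : Fin 2 => if i.val + j.val + 1 = 2 then (1 : L) else 0)).Local v ×
        (UnitaryGroup.cmDatum L 1 (Matrix.of fun i j : Fin 1 => if i.val + j.val + 1 = 1 then (1 : L) else 0)).Local v)) =
      ((Subgroup.centralizer ({γ₀} : Set ↥(unitaryGroupOfForm (conjLocal L (IsCMField.complexConj L) v) (cmLocalForm L 2 v)))) :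
        Set ↥(unitaryGroupOfForm (conjLocal L (IsCMField.complexConj L) v) (cmLocalForm L 2 v))) := by
    ext h
    constructor
    · rintro ⟨p, hp, rfl⟩
      have hp' : p ∈ Subgroup.centralizer ({(a, b)} :
          Set ((UnitaryGroup.cmDatum L 2 (Matrix.of fun i j : Fin 2 => if i.val + j.val + 1 = 2 then (1 : L) else 0)).Local v ×
            (UnitaryGroup.cmDatum L 1 (Matrix.of fun i j : Fin 1 => if i.val + j.val + 1 = 1 then (1 : L) else 0)).Local v)) := hp
      have hp1 : p.1 * a = a * p.1 := congrArg Prod.fst (Subgroup.mem_centralizer_singleton_iff.1 hp')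
      have goal : (p.1 : ↥(unitaryGroupOfForm (conjLocal L (IsCMField.complexConj L) v) (cmLocalForm L 2 v))) ∈
          Subgroup.centralizer ({γ₀} : Set ↥(unitaryGroupOfForm (conjLocal L (IsCMField.complexConj L) v) (cmLocalForm L 2 v))) :=
        Subgroup.mem_centralizer_singleton_iff.2 hp1
      exact goal
    · intro hh
      have hh' : (h : ↥(unitaryGroupOfForm (conjLocal L (IsCMField.complexConj L) v) (cmLocalForm L 2 v))) ∈
          Subgroup.centralizer ({γ₀} : Set ↥(unitaryGroupOfForm (conjLocal L (IsCMField.complexConj L) v) (cmLocalForm L 2 v))) := hh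
      have hh1 : h * a = a * h := Subgroup.mem_centralizer_singleton_iff.1 hh'
      refine ⟨(h, 1), ?_, rfl⟩
      have goal : (h, 1) ∈ Subgroup.centralizer ({(a, b)} :
          Set ((UnitaryGroup.cmDatum L 2 (Matrix.of fun i j : Fin 2 => if i.val + j.val + 1 = 2 then (1 : L) else 0)).Local v ×
            (UnitaryGroup.cmDatum L 1 (Matrix.of fun i j : Fin 1 => if i.val + j.val + 1 = 1 then (1 : L) else 0)).Local v)) :=
        Subgroup.mem_centralizer_singleton_iff.2 (Prod.ext hh1 (by simp only [Prod.snd_mul, one_mul, mul_one]))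
      exact goal
  have hncH : ¬ IsCompact ((Subgroup.centralizer ({(a, b)} :
      Set ((UnitaryGroup.cmDatum L 2 (Matrix.of fun i j : Fin 2 => if i.val + j.val + 1 = 2 then (1 : L) else 0)).Local v ×
        (UnitaryGroup.cmDatum L 1 (Matrix.of fun i j : Fin 1 => if i.val + j.val + 1 = 1 then (1 : L) else 0)).Local v))) :
      Set ((UnitaryGroup.cmDatum L 2 (Matrix.of fun i j : Fin 2 => if i.val + j.val + 1 = 2 then (1 : L) else 0)).Local v ×
        (UnitaryGroup.cmDatum L 1 (Matrix.of fun i j : Fin 1 => if i.val + j.val + 1 = 1 then (1 : L) else 0)).Local v)) := by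
    intro hc
    apply hnc
    rw [← himg]
    exact hc.image continuous_fst
  -- hence `ι_v(a, b) ∈ Ω`, hence a root `α` of `χ_{γ₀}` with `α σ(α) ≠ 1`
  have hΩ : endoEmbLocal L v (a, b) ∈ F0P3cStCharTSTorusDefs.hyperbolicSet L v := by
    by_contra h
    exact hncH ((F0P3cStCharTSEllCartanCompactH.isCompact_centralizer_iff_not_mem_hyperbolicSet_H L v hns (a, b) hγ).2 h)
  obtain ⟨α, hα, hne⟩ := F0P3cStCharTSStableInvariantsH.exists_isRoot_charpoly_fst_of_mem_hyperbolicSet L v hns hΩ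
  have hαa : (((γ₀ : GL (Fin 2) (LocalRing L v)) : Matrix (Fin 2) (Fin 2) (LocalRing L v)).charpoly).IsRoot α := hα
  -- conjugate `γ₀` into the split torus
  obtain ⟨x₀, hx₀T, -⟩ := F0P3cStCharTSHypConjTwo.exists_conj_mem_torusU_of_isRoot_of_isUnit₂ (conjLocal L (IsCMField.complexConj L) v) hR
    (conjLocal_conjLocal_cm L v) (cmLocalForm_eq_over L 2 v) hreg hαa hne
  have hregm : IsRegularElt (((x₀ * γ₀ * x₀⁻¹ : ↥(unitaryGroupOfForm (conjLocal L (IsCMField.complexConj L) v) (cmLocalForm L 2 v))) : GL (Fin 2) (LocalRing L v))) :=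
    (F0P3cStCharTSEllipticCriterion.isRegularElt_coe_conj_iff _ _ γ₀ x₀).2 hreg
  have hZ : Subgroup.centralizer ({x₀ * γ₀ * x₀⁻¹} : Set ↥(unitaryGroupOfForm (conjLocal L (IsCMField.complexConj L) v) (cmLocalForm L 2 v))) = (cmBorelTriple L 2 v).M :=
    F0P3cStCharTSWeylHypFibre.centralizer_eq_torusU_of_isRegularElt (conjLocal L (IsCMField.complexConj L) v) (cmLocalForm L 2 v) hx₀T hregm
  refine ⟨x₀⁻¹, ⟨x₀ * γ₀ * x₀⁻¹, hx₀T⟩, hregm, by group, fun g => ?_⟩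
  -- `g ∈ Z(γ₀) ↔ x₀ g x₀⁻¹ ∈ Z(x₀ γ₀ x₀⁻¹) = M₂`
  rw [← hZ, inv_inv, Subgroup.mem_centralizer_singleton_iff, Subgroup.mem_centralizer_singleton_iff]
  constructor
  · intro hg
    have : x₀ * (g * γ₀) * x₀⁻¹ = x₀ * (γ₀ * g) * x₀⁻¹ := by rw [hg]
    calc x₀ * g * x₀⁻¹ * (x₀ * γ₀ * x₀⁻¹) = x₀ * (g * γ₀) * x₀⁻¹ := by group
      _ = x₀ * (γ₀ * g) * x₀⁻¹ := this
      _ = x₀ * γ₀ * x₀⁻¹ * (x₀ * g * x₀⁻¹) := by group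
  · intro hg
    have h1 : g * γ₀ = x₀⁻¹ * (x₀ * g * x₀⁻¹ * (x₀ * γ₀ * x₀⁻¹)) * x₀ := by group
    have h2 : γ₀ * g = x₀⁻¹ * (x₀ * γ₀ * x₀⁻¹ * (x₀ * g * x₀⁻¹)) * x₀ := by group
    rw [h1, h2, hg]

/-! ## §1 (d) The Cartan dichotomy at the model: a regular element with non-compact centraliser is conjugate into the diagonal torus -/

variable (w : PlacesOver L v) (hw : IsCMField.complexConj L • w.1 = w.1)

set_option maxHeartbeats 800000 in
-- `isDefEq` across the two spellings of the carrier (`«local» L c 2 Φ₂ v` vs `U(c ⊗ 1, cmLocalForm L 2 v)`) in the final rewrites; same class and value as the ★ `Fin 3`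
-- template `K2E3SupercuspModelFrameAtPlaceCartan.exists_conj_torusU_of_not_isCompact_centralizer`
/-- **THE CARTAN DICHOTOMY ON `U(σ_w, Φ₂)(L_w)`.**  For `g ∈ U = U(σ_w, J)(L_w)`, `J = Φ₂`, REGULAR (separable characteristic polynomial, ★ `IsRegularElt`) with NON-COMPACT
centraliser: `g = y t y⁻¹` with `t = diag d ∈ T` regular, and `h ∈ Z(g) ↔ y⁻¹ h y ∈ T` — transport of §1a `exists_conj_cmTorus_of_not_isCompact_centralizer₂` (`U(Φ₂)(L⁺_v)`, `v`
non-split: the Cartan subgroups other than the split `M₂` are compact) along the one-place model ★ `localNonsplitEquiv`.  The `Fin 2` twin of ★ [M2a]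
`exists_conj_torusU_of_not_isCompact_centralizer`. [cite: Rogawski1990, §3.6 pp. 28–31; §12.5 pp. 182, 184] [cite: PlatonovRapinchuk1994, §5.1] -/
theorem exists_conj_torusU_of_not_isCompact_centralizer {J : Matrix (Fin 2) (Fin 2) (w.1.adicCompletion L)}
    (hJ : J = (StdForm.antidiagonal 2).over (w.1.adicCompletion L))
    {g : ↥(unitaryGroupOfForm (galAdicCompletionMap (L := L) (IsCMField.complexConj L) hw) J)}
    (hreg : IsRegularElt (g : GL (Fin 2) (w.1.adicCompletion L)))
    (hnc : ¬ IsCompact ((Subgroup.centralizer ({g} : Set ↥(unitaryGroupOfForm (galAdicCompletionMap (L := L) (IsCMField.complexConj L) hw) J)) :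
      Subgroup ↥(unitaryGroupOfForm (galAdicCompletionMap (L := L) (IsCMField.complexConj L) hw) J)) :
        Set ↥(unitaryGroupOfForm (galAdicCompletionMap (L := L) (IsCMField.complexConj L) hw) J))) :
    ∃ (y t : ↥(unitaryGroupOfForm (galAdicCompletionMap (L := L) (IsCMField.complexConj L) hw) J)) (d : Fin 2 → (w.1.adicCompletion L)ˣ),
      glDiagonal 2 (w.1.adicCompletion L) d = (t : GL (Fin 2) (w.1.adicCompletion L)) ∧ IsRegularElt (t : GL (Fin 2) (w.1.adicCompletion L)) ∧
      g = y * t * y⁻¹ ∧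
      ∀ h : ↥(unitaryGroupOfForm (galAdicCompletionMap (L := L) (IsCMField.complexConj L) hw) J),
        h ∈ Subgroup.centralizer ({g} : Set ↥(unitaryGroupOfForm (galAdicCompletionMap (L := L) (IsCMField.complexConj L) hw) J)) ↔
          y⁻¹ * h * y ∈ torusU (galAdicCompletionMap (L := L) (IsCMField.complexConj L) hw) J := by
  obtain rfl : J = placeForm (Matrix.of fun i j : Fin 2 => if i.val + j.val + 1 = 2 then (1 : L) else 0) w.1 :=
    hJ.trans (F0P3cCMLocalNonsplitBorelTransportU2.placeForm_antidiagTwo_eq L v w).symm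
  have hns : ∀ w' : PlacesOver L v, IsCMField.complexConj L • w'.1 = w'.1 := fun w' => by
    haveI := PlacesOver.subsingleton_of_smul_eq (IsCMField.complexConj L) (IsCMField.complexConj_ne_one L) w hw
    rw [Subsingleton.elim w' w]; exact hw
  set e := localNonsplitEquiv (IsCMField.complexConj L) (Matrix.of fun i j : Fin 2 => if i.val + j.val + 1 = 2 then (1 : L) else 0)
    (IsCMField.complexConj_ne_one L) w hw with he
  -- `γ₀ := e⁻¹ g` on `U(Φ₂)(L⁺_v)`: regular, with non-compact centraliser
  set γ₀ := e.symm g with hγ₀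
  have heγ₀ : e γ₀ = g := e.apply_symm_apply g
  have hreg₀ : IsRegularElt ((γ₀ : «local» L (IsCMField.complexConj L) 2 (Matrix.of fun i j : Fin 2 => if i.val + j.val + 1 = 2 then (1 : L) else 0) v) :
      GL (Fin 2) (LocalRing L v)) := by
    refine (isRegularElt_iff_charpoly_separable_localNonsplitEquiv (IsCMField.complexConj L) 2
      (Matrix.of fun i j : Fin 2 => if i.val + j.val + 1 = 2 then (1 : L) else 0) (IsCMField.complexConj_ne_one L) w hw γ₀).2 ?_
    rw [← he, heγ₀]
    exact hreg
  -- centralisers correspond along `e` (`e γ₀ = g`)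
  have key : ∀ h₀ : «local» L (IsCMField.complexConj L) 2 (Matrix.of fun i j : Fin 2 => if i.val + j.val + 1 = 2 then (1 : L) else 0) v,
      e h₀ ∈ Subgroup.centralizer ({g} : Set _) ↔ h₀ ∈ Subgroup.centralizer ({γ₀} : Set _) :=
    fun h₀ => Literature.MeasureTheory.Group.forall_apply_mem_centralizer_singleton_iff_of_eq e.toMulEquiv heγ₀ h₀
  have key' : ∀ h, h ∈ Subgroup.centralizer ({g} : Set _) ↔ e.symm h ∈ Subgroup.centralizer ({γ₀} : Set _) := by
    intro h
    have h1 := key (e.symm h)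
    rwa [ContinuousMulEquiv.apply_symm_apply] at h1
  have hZimage : (e : «local» L (IsCMField.complexConj L) 2 (Matrix.of fun i j : Fin 2 => if i.val + j.val + 1 = 2 then (1 : L) else 0) v → _) ''
      ((Subgroup.centralizer ({γ₀} : Set _) : Subgroup _) : Set _) = ((Subgroup.centralizer ({g} : Set _) : Subgroup _) : Set _) := by
    ext h
    constructor
    · rintro ⟨h₀, hh₀, rfl⟩
      exact (key h₀).2 hh₀
    · intro hh
      exact ⟨e.symm h, (key' h).1 hh, e.apply_symm_apply h⟩
  have hnc₀ : ¬ IsCompact ((Subgroup.centralizer ({γ₀} :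
      Set («local» L (IsCMField.complexConj L) 2 (Matrix.of fun i j : Fin 2 => if i.val + j.val + 1 = 2 then (1 : L) else 0) v)) :
        Subgroup («local» L (IsCMField.complexConj L) 2 (Matrix.of fun i j : Fin 2 => if i.val + j.val + 1 = 2 then (1 : L) else 0) v)) :
      Set («local» L (IsCMField.complexConj L) 2 (Matrix.of fun i j : Fin 2 => if i.val + j.val + 1 = 2 then (1 : L) else 0) v)) := by
    intro hc
    apply hnc
    rw [← hZimage]
    exact hc.image (show Continuous (e : «local» L (IsCMField.complexConj L) 2 (Matrix.of fun i j : Fin 2 => if i.val + j.val + 1 = 2 then (1 : L) else 0) v → _)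
      from e.continuous)
  -- the CM Cartan dichotomy (§1a)
  obtain ⟨x, m, hmreg, hconj, hZ⟩ := exists_conj_cmTorus_of_not_isCompact_centralizer₂ L (v := v) hns (γ₀ := γ₀) hreg₀ hnc₀
  -- respell the CM data on the one-place carrier `«local» L c 2 Φ₂ v` (definitionally the same topological group)
  set x' : «local» L (IsCMField.complexConj L) 2 (Matrix.of fun i j : Fin 2 => if i.val + j.val + 1 = 2 then (1 : L) else 0) v := x with hx'
  set m' : «local» L (IsCMField.complexConj L) 2 (Matrix.of fun i j : Fin 2 => if i.val + j.val + 1 = 2 then (1 : L) else 0) v :=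
    (m : ↥(unitaryGroupOfForm (conjLocal L (IsCMField.complexConj L) v) (cmLocalForm L 2 v))) with hm'
  have hconj' : x' * m' * x'⁻¹ = γ₀ := hconj
  have hZ' : ∀ h₀ : «local» L (IsCMField.complexConj L) 2 (Matrix.of fun i j : Fin 2 => if i.val + j.val + 1 = 2 then (1 : L) else 0) v,
      h₀ ∈ Subgroup.centralizer ({γ₀} : Set _) ↔ x'⁻¹ * h₀ * x' ∈ (cmBorelTriple L 2 v).M :=
    fun h₀ => hZ h₀
  -- transport back: `y := e x`, `t := e m`
  have htT : e m' ∈ torusU (galAdicCompletionMap (L := L) (IsCMField.complexConj L) hw)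
      (placeForm (Matrix.of fun i j : Fin 2 => if i.val + j.val + 1 = 2 then (1 : L) else 0) w.1) :=
    (F0P3cCMLocalNonsplitBorelTransportU2.localNonsplitEquiv_mem_torusU_iff₂ L v w hw m').2 m.2
  obtain ⟨d, hd⟩ := (mem_torusU_iff _).1 htT
  have htreg : IsRegularElt (((e m') : ↥(unitaryGroupOfForm (galAdicCompletionMap (L := L) (IsCMField.complexConj L) hw)
      (placeForm (Matrix.of fun i j : Fin 2 => if i.val + j.val + 1 = 2 then (1 : L) else 0) w.1))) : GL (Fin 2) (w.1.adicCompletion L)) :=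
    (isRegularElt_iff_charpoly_separable_localNonsplitEquiv (IsCMField.complexConj L) 2
      (Matrix.of fun i j : Fin 2 => if i.val + j.val + 1 = 2 then (1 : L) else 0) (IsCMField.complexConj_ne_one L) w hw m').1 hmreg
  refine ⟨e x', e m', d, hd, htreg, ?_, fun h => ?_⟩
  · rw [← heγ₀, ← hconj', map_mul, map_mul, map_inv]
  · -- `h ∈ Z(g) ↔ e⁻¹ h ∈ Z(γ₀) ↔ x⁻¹ (e⁻¹ h) x ∈ M₂ ↔ e(x⁻¹ (e⁻¹ h) x) = y⁻¹ h y ∈ T`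
    rw [key' h, hZ' (e.symm h), ← F0P3cCMLocalNonsplitBorelTransportU2.localNonsplitEquiv_mem_torusU_iff₂ L v w hw (x'⁻¹ * e.symm h * x'), ← he,
      map_mul, map_mul, map_inv, ContinuousMulEquiv.apply_symm_apply]

/-! ## §2 (f) The support datum of the supercuspidal slice at the model -/

set_option synthInstance.maxHeartbeats 400000 in
set_option maxHeartbeats 1600000 in
-- instance-term unification on the model carriers (same class and value as the ★ `Fin 3` template)
/-- **(Φ_C (i), support `⊆ C·T`) ON THE MODEL `U(σ_w, Φ₂)(L_w)`** for `θ = B u′ (ρ(·) u)` a supercuspidal coefficient (`ρ` smooth supercuspidal — NO irreducibility —, `B`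
`U`-invariant; compact support by ★ `IsSupercuspidal.hasCompactSupport_sesqForm_apply_apply` and the compact centre ★ FILE A₂ `isCompact_center_of_eq_over`) and `t = diag d`
REGULAR: `∃ C` compact with `f_t(x) ≠ 0 ⇒ x ∈ C·T` — Harish-Chandra's Lemma 14 at the model (★ `UnitaryGroupOfForm.isCompact_image_mk_setOf_exists_conj_mem_of_charpoly_separable`
at `m := 2`, `E = L_w` normed by ★ `Valued.toNontriviallyNormedField`, `K = {t}`, `C = tsupport θ`), read through ★ `exists_isCompact_subset_mul_of_isCompact_image_mk` and `Z(t) = T`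
(★ `mem_torusU_iff_mem_centralizer_of_isUnit_sub`).  The `Fin 2` twin of ★ [M2a] `exists_isCompact_support_coeff_conj_subset_mul_torusU` (the `hsupp` of the Theorem-20-type
cancellation files of the (M5h₂) chain for `f := f_t`). [cite: HarishChandra1970, Part I §3 Lemma 14 p. 9; Part VII §2 p. 70 (i)] [cite: Rogawski1990, §4.9 p. 54] -/
theorem exists_isCompact_support_coeff_conj_subset_mul_torusU {J : Matrix (Fin 2) (Fin 2) (w.1.adicCompletion L)}
    (hJ : J = (StdForm.antidiagonal 2).over (w.1.adicCompletion L))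
    {V : Type*} [AddCommGroup V] [Module ℂ V]
    (ρ : Representation ℂ ↥(unitaryGroupOfForm (galAdicCompletionMap (L := L) (IsCMField.complexConj L) hw) J) V) (hsm : ρ.IsSmooth) (hsc : ρ.IsSupercuspidal)
    (B : V →ₗ⋆[ℂ] V →ₗ[ℂ] ℂ)
    (hBinv : ∀ (g : ↥(unitaryGroupOfForm (galAdicCompletionMap (L := L) (IsCMField.complexConj L) hw) J)) (x y : V), B (ρ g x) (ρ g y) = B x y)
    (t : ↥(unitaryGroupOfForm (galAdicCompletionMap (L := L) (IsCMField.complexConj L) hw) J)) {d : Fin 2 → (w.1.adicCompletion L)ˣ}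
    (hd : glDiagonal 2 (w.1.adicCompletion L) d = (t : GL (Fin 2) (w.1.adicCompletion L))) (hreg : IsRegularElt (t : GL (Fin 2) (w.1.adicCompletion L)))
    (u u' : V) :
    ∃ C : Set ↥(unitaryGroupOfForm (galAdicCompletionMap (L := L) (IsCMField.complexConj L) hw) J), IsCompact C ∧
      ∀ x : ↥(unitaryGroupOfForm (galAdicCompletionMap (L := L) (IsCMField.complexConj L) hw) J), B u' (ρ (x * t * x⁻¹) u) ≠ 0 →
        x ∈ C * (torusU (galAdicCompletionMap (L := L) (IsCMField.complexConj L) hw) J :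
          Set ↥(unitaryGroupOfForm (galAdicCompletionMap (L := L) (IsCMField.complexConj L) hw) J)) := by
  have hZc := K2E3SupercuspModelFrameAtPlaceTwo.isCompact_center_of_eq_over L w hw hJ
  subst hJ
  letI : NontriviallyNormedField (w.1.adicCompletion L) := Valued.toNontriviallyNormedField (w.1.adicCompletion L) (WithZero (Multiplicative ℤ))
  haveI : CharZero (w.1.adicCompletion L) := charZero_of_injective_algebraMap (algebraMap L (w.1.adicCompletion L)).injective
  haveI : LocallyCompactSpace (GL (Fin 2) (w.1.adicCompletion L)) := locallyCompactSpace_gl_adicCompletion L 2 w.1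
  haveI : SecondCountableTopology (GL (Fin 2) (w.1.adicCompletion L)) := secondCountableTopology_gl_adicCompletion L 2 w.1
  haveI : SigmaCompactSpace (GL (Fin 2) (w.1.adicCompletion L)) := sigmaCompactSpace_of_locallyCompact_secondCountable
  haveI : LocallyCompactSpace ↥(unitaryGroupOfForm (galAdicCompletionMap (L := L) (IsCMField.complexConj L) hw) ((StdForm.antidiagonal 2).over (w.1.adicCompletion L))) :=
    K2E3SupercuspModelFrameAtPlaceTwo.locallyCompactSpace_unitaryGroupOfForm_adicCompletion L w hw _
  have hσc : Continuous (galAdicCompletionMap (L := L) (IsCMField.complexConj L) hw) := continuous_galAdicCompletionMap L (IsCMField.complexConj L) hw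
  have hσσ : ∀ x, galAdicCompletionMap (L := L) (IsCMField.complexConj L) hw (galAdicCompletionMap (L := L) (IsCMField.complexConj L) hw x) = x :=
    galAdicCompletionMap_galAdicCompletionMap_of_smul_eq (IsCMField.complexConj L) w (IsCMField.complexConj_ne_one L) hw
  have hreg' : IsRegularElt (glDiagonal 2 (w.1.adicCompletion L) d) := by rw [hd]; exact hreg
  -- the coefficient has compact support (compact centre)
  have hθ : HasCompactSupport fun g : ↥(unitaryGroupOfForm (galAdicCompletionMap (L := L) (IsCMField.complexConj L) hw)
      ((StdForm.antidiagonal 2).over (w.1.adicCompletion L))) => B u' (ρ g u) :=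
    hsc.hasCompactSupport_sesqForm_apply_apply hZc hsm hBinv u u'
  -- Harish-Chandra's Lemma 14 at the model, `K = {t}`, `C = tsupport θ` (`Φ₂` hermitian with unit determinant: ★ `StdForm.over_map`, `StdForm.transpose_over`, `StdForm.isUnit_over`)
  have hJh : (((StdForm.antidiagonal 2).over (w.1.adicCompletion L)).map (galAdicCompletionMap (L := L) (IsCMField.complexConj L) hw))ᵀ =
      (StdForm.antidiagonal 2).over (w.1.adicCompletion L) := by
    rw [StdForm.over_map, StdForm.transpose_over]
  have hJd : IsUnit ((StdForm.antidiagonal 2).over (w.1.adicCompletion L)).det :=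
    (Matrix.isUnit_iff_isUnit_det _).1 ((StdForm.antidiagonal 2).isUnit_over (w.1.adicCompletion L))
  have hA := UnitaryGroupOfForm.isCompact_image_mk_setOf_exists_conj_mem_of_charpoly_separable (m := 2) two_ne_zero hσc hσσ hJh hJd t hreg isCompact_singleton
    (Set.singleton_subset_iff.2 (Subgroup.mem_centralizer_singleton_iff.2 rfl)) (fun t' ht' => by rw [Set.mem_singleton_iff.1 ht']; exact hreg) hθ.isCompact
  have hS : IsCompact ((QuotientGroup.mk : ↥(unitaryGroupOfForm (galAdicCompletionMap (L := L) (IsCMField.complexConj L) hw) ((StdForm.antidiagonal 2).over (w.1.adicCompletion L))) →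
      ↥(unitaryGroupOfForm (galAdicCompletionMap (L := L) (IsCMField.complexConj L) hw) ((StdForm.antidiagonal 2).over (w.1.adicCompletion L))) ⧸
        Subgroup.centralizer ({t} : Set _)) ''
      {x | x * t * x⁻¹ ∈ tsupport fun g : ↥(unitaryGroupOfForm (galAdicCompletionMap (L := L) (IsCMField.complexConj L) hw)
        ((StdForm.antidiagonal 2).over (w.1.adicCompletion L))) => B u' (ρ g u)}) := by
    have hset : {x : ↥(unitaryGroupOfForm (galAdicCompletionMap (L := L) (IsCMField.complexConj L) hw) ((StdForm.antidiagonal 2).over (w.1.adicCompletion L))) |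
        ∃ t' ∈ ({t} : Set _), x * t' * x⁻¹ ∈ tsupport fun g : ↥(unitaryGroupOfForm (galAdicCompletionMap (L := L) (IsCMField.complexConj L) hw)
          ((StdForm.antidiagonal 2).over (w.1.adicCompletion L))) => B u' (ρ g u)} =
        {x | x * t * x⁻¹ ∈ tsupport fun g : ↥(unitaryGroupOfForm (galAdicCompletionMap (L := L) (IsCMField.complexConj L) hw)
          ((StdForm.antidiagonal 2).over (w.1.adicCompletion L))) => B u' (ρ g u)} := by
      ext x; simp only [Set.mem_setOf_eq, Set.mem_singleton_iff, exists_eq_left]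
    rw [← hset]; exact hA
  obtain ⟨C, hC, hsub⟩ := K2E3UnipotentConjTwistBochner.exists_isCompact_subset_mul_of_isCompact_image_mk (Subgroup.centralizer {t}) hS
  have hT : torusU (galAdicCompletionMap (L := L) (IsCMField.complexConj L) hw) ((StdForm.antidiagonal 2).over (w.1.adicCompletion L)) =
      Subgroup.centralizer ({t} : Set _) :=
    Subgroup.ext fun g => mem_torusU_iff_mem_centralizer_of_isUnit_sub hd
      (fun i j hij => F0P3cStCharTSWeylHypFibre.isUnit_sub_of_isRegularElt_glDiagonal hreg' hij) g
  refine ⟨C, hC, fun x hx => ?_⟩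
  rw [hT]
  exact hsub (subset_tsupport _ (Function.mem_support.2 hx))

end Summit.HodgeConjecture.HodgeConjecture.Cruxes.H413.K2E3SupercuspModelFrameAtPlaceCartanTwo

end
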